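import Literature.NumberTheory.Rogawski1990.LevelOnePieceDepthOneStrataConstancyRamified   -- ★ p846899 (this lineage, p05 (g15)): «U-ram depth 1» `apply_eq_apply_of_depthOne_conj_ramified`; brings ★ p846857 §B `exists_residueFrame_of_integralFrame`, ★ p846840, `redMat`, `ValBound`
import Literature.GroupTheory.SpecificGroups.OrthogonalThreeSymmetricNilpotentOrbitsFrame     -- ★ p846957 (F0P3-p03 (g14)): the `𝔭`-layer finite half AT A RESIDUAL FRAME `J̄ = c • formCongr σ' Ā J₀` ((F2) rank two, (F3) rank ≤ 1 + common value, `formAdjoint_id_eq_self_iff_transpose_mul`)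
import Literature.NumberTheory.Automorphic.UnitaryTwoResiduallyUnipotentTrivialRamified       -- ★ p846905 (F0P2-p06 (g12)): `redMat_map_galAdicCompletionMap_eq_of_ramified` (`σ̄_w = id` on integral matrices), `red_galAdicCompletionMap_eq_of_ramified`
import Literature.NumberTheory.Automorphic.RamifiedPlaceAntiFixedUniformizer                  -- ★ `valued_toPlace_uniformizer_of_ramified` (`|ι_w(ϖ_v)|_w = exp(−2)`: the :118 level token is `ϖ_w²`)
import HarnessLib

/-!
# «(U)-ram DEPTH 1 — STRATA VALUES» (S3-ram row (b1) «(U)-ram two-layer head»: the DEPTH-1 organ beneath F0P2-p01 (g15)'s HEAD `exists_twoLayerStrataValues_of_levelOne_ramified`,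
# rows (R2)(R3)(R4)(R5) of its statement-first v2 42aa586084cc7c78 VERBATIM)

Topic `NumberTheory/Rogawski1990`; namespace `Literature.NumberTheory.Rogawski1990`.  THEOREMS ONLY (no definition, no instance, no notation, no named fact, no `sorry`).
Hand F0P3a-p05 (g16), 2026-09-01.  Cell `pub/hodgecm-mathlib`, crux H413 = `stmt-HodgeConjecture-24833`; road «S3-ram» seeding wave (LEAD F0P3a-plan (g12) T11-41;
owner∕table F0P3a-p06 (g15) v1.5); consumer: F0P2-p01 (g15)'s TWO-LAYER (U)-ram HEAD (END F0P3a-p03 (g16) fold v6 socket `stub_levelOneRowsRam` :118, internal organ),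
which closes by `exact ⟨c, c', c₁, (R1), (this file)⟩`.

THE MATHEMATICS ([Rogawski1990] §4.9 p. 54, §3.9 p. 32; [BruhatTits1972] §10).  `L` CM, `v` a finite place of `L⁺` non-split and TAME-RAMIFIED in `L` (`w ∣ v`, uniformiser
`ϖ` with `σ_w ϖ = −ϖ`, `σ̄_w = id`, `2 ∈ 𝒪_w^×`), `K = U(H′)(𝒪_v)` hyperspecial with residual form `J̄ = red H′_w = c̄ • Āᵀ J₀ Ā` (★ `exists_residueFrame_of_integralFrame` on the
integral antidiagonal frame `(A, hA, hframe)` of the fold).  §B: for `k ∈ K` with `k_w ≡ 1 (ϖ)` the DEPTH-1 RESIDUE `N(k) := red(ϖ⁻¹(k_w − 1))` lies in the SYMMETRIC layer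
`𝔭(J̄) = {X : J̄X = XᵀJ̄}`: unitarity `σ(k_w)ᵀ H′_w k_w = H′_w` gives `H′_w (k_w − 1) = −σ(k_w − 1)ᵀ H′_w k_w`, and `σ(k_w − 1) = σ(ϖ)·σ(X) = −ϖ·σ(X)` for `k_w − 1 = ϖX`, so
`H′_w X = σ(X)ᵀ H′_w k_w`; reduce (`k̄_w = 1`, `σ̄ = id`): `J̄ X̄ = X̄ᵀ J̄`.  §C: by ★ p846957 (F0P3-p03 (g14)) two NILPOTENT `X, X′ ∈ 𝔭(J̄)` are `O(J̄)(𝓀_w)`-conjugate when both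
have rank `2`, or both have rank `≤ 1` and their residual quadratic forms `z ↦ zᵀ(J̄X)z` take a common non-zero value; ★ p846899 `apply_eq_apply_of_depthOne_conj_ramified` (Hensel lift of
the conjugator, ★ p846840) turns that into `g k = g k′` for a `v`-level-1 `K`-class piece `g`.  Packaging by choice gives the STRATA-VALUE ROWS (R2)–(R5): `∃ c′ c₁`, `g k = c′ 0` on
depth-1 rank `0`, `g k = c′ 2` on depth-1 rank `2`, `g k = c₁ (zᵀ(J̄N(k))z)` on depth-1 rank `1` for every non-zero value, and `c₁ (a²t) = c₁ t`.  No RIGID input (row (R1), the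
boundary-regular `v`-deep class, is F0P2-p01's FILE B over ★ p846886); no new definition; the level token of the binder `hg1` is the fold's `(ι_w ϖ_v)^1` (`|ι_w ϖ_v|_w = |ϖ|_w²`,
★ `valued_toPlace_uniformizer_of_ramified`), bridged to ★ p846899's `(ϖ²)⁻¹` inside the proof.
HONEST LABEL: HC_CM is proved only modulo the 2 remaining named inputs (hLiu418 24832, h413 24833) until rung 0 closes; unconditional local algebra, no books consequence.

## References
* [Rogawski1990] J. D. Rogawski, *Automorphic Representations of Unitary Groups in Three Variables*, Ann. of Math. Stud. 123 (1990): §4.9 p. 54, §3.9 p. 32, §1.10 p. 9.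
* [BruhatTits1972] F. Bruhat, J. Tits, *Groupes réductifs sur un corps local* I, Publ. Math. IHÉS 41 (1972): §10 (congruence filtrations; graded layers of parahorics).
* [PlatonovRapinchuk1994] V. Platonov, A. Rapinchuk, *Algebraic Groups and Number Theory* (1994): §3.3 (reduction of integral forms, Hensel).
* [CollingwoodMcGovern1993] D. Collingwood, W. McGovern, *Nilpotent Orbits in Semisimple Lie Algebras* (1993): §9.3 (orbits by rank and square class).
-/

set_option autoImplicit false

noncomputable section

open NumberField IsDedekindDomain Matrix ValuativeRel
open Literature.NumberTheory.Automorphic Literature.NumberTheory.GaloisRepresentations Literature.NumberTheory.Automorphic.UnitaryGroup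
open Literature.NumberTheory.Automorphic.IntegralReduction Literature.GroupTheory.SpecificGroups
open scoped Matrix MatrixGroups ValuativeRel

namespace Literature.NumberTheory.Rogawski1990

/-! ## §B The depth-1 residue lies in the symmetric layer `𝔭(J̄) = {X : J̄ X = Xᵀ J̄}` -/

section SymmetricLayer

/-- `(c • X).map σ = σ c • X.map σ` for a ring homomorphism `σ`. [folklore] -/
private theorem map_smul_ringHom {R : Type*} [CommRing R] (σ : R →+* R) (c : R) (X : Matrix (Fin 3) (Fin 3) R) :
    (c • X).map σ = σ c • X.map σ := by
  ext i j
  simp only [Matrix.map_apply, Matrix.smul_apply, smul_eq_mul, map_mul]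

set_option maxHeartbeats 800000 in
-- budget only: statement-heavy CM-place tokens; no long search tactic.
/-- **THE DEPTH-1 RESIDUE IS `J̄`-SYMMETRIC (tame-ramified place).**  For `k ∈ K = U(H′)(𝒪_v)` with `k_w ≡ 1 (ϖ)` (`ϖ` a uniformiser of `L_w` with `σ_w ϖ = −ϖ`):
`red H′_w · red(ϖ⁻¹(k_w − 1)) = red(ϖ⁻¹(k_w − 1))ᵀ · red H′_w` — the odd graded layers of the ramified `U₃` are the SYMMETRIC part `𝔭`
(unitarity `σ(k_w)ᵀ H′_w k_w = H′_w` ⇒ `H′_w X = σ(X)ᵀ H′_w k_w` for `k_w = 1 + ϖX`, reduced with `k̄_w = 1` and `σ̄_w = id` ★ `redMat_map_galAdicCompletionMap_eq_of_ramified`).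
[cite: BruhatTits1972, §10] [cite: Rogawski1990, §3.9 p. 32; §4.9 p. 54] -/
theorem redMat_placeForm_mul_depthOne_eq_transpose_mul_of_ramified
    (L : Type) [Field L] [NumberField L] [IsCMField L] (H' : Matrix (Fin 3) (Fin 3) L)
    {v : HeightOneSpectrum (𝓞 ↥(maximalRealSubfield L))}
    (w : PlacesOver L v) (hw : IsCMField.complexConj L • w.1 = w.1) (he : v.asIdeal.ramificationIdx' w.1.asIdeal ≠ 1)
    (hH'w : IsUnit (placeForm H' w.1)) (hH'i : hH'w.unit ∈ glInt 3 (w.1.adicCompletion L))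
    (ϖ : (w.1.adicCompletion L)) (hϖ : Valued.v ϖ = WithZero.exp (-1 : ℤ)) (hσϖ : (galAdicCompletionMap (L := L) (IsCMField.complexConj L) hw) ϖ = -ϖ)
    {k : ((cmDatum L 3 H').Local v)} (hk : k ∈ (cmLocalIntegralLevel L 3 H' v)) (hk1 : (∀ a b, Valued.v (ϖ⁻¹ * ((((k).val : GL (Fin 3) (UnitaryGroup.LocalRing L v)).val.map (Pi.evalRingHom (fun w' : PlacesOver L v => w'.1.adicCompletion L) w)) a b - (1 : Matrix (Fin 3) (Fin 3) (w.1.adicCompletion L)) a b)) ≤ 1)) :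
    redMat (placeForm H' w.1) * redMat (ϖ⁻¹ • ((((k).val : GL (Fin 3) (UnitaryGroup.LocalRing L v)).val.map (Pi.evalRingHom (fun w' : PlacesOver L v => w'.1.adicCompletion L) w)) - 1)) = (redMat (ϖ⁻¹ • ((((k).val : GL (Fin 3) (UnitaryGroup.LocalRing L v)).val.map (Pi.evalRingHom (fun w' : PlacesOver L v => w'.1.adicCompletion L) w)) - 1)))ᵀ * redMat (placeForm H' w.1) := by
  classical
  have hc1 : IsCMField.complexConj L ≠ 1 := IsCMField.complexConj_ne_one L
  -- names: `M = k_w`, `D = M − 1`, `X = ϖ⁻¹ • D`, their `σ_w`-images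
  set M : Matrix (Fin 3) (Fin 3) (w.1.adicCompletion L) := (((k).val : GL (Fin 3) (UnitaryGroup.LocalRing L v)).val.map (Pi.evalRingHom (fun w' : PlacesOver L v => w'.1.adicCompletion L) w)) with hMdef
  have hMe : ((((localNonsplitEquiv (IsCMField.complexConj L) H' (IsCMField.complexConj_ne_one L) w hw k) : ↥(unitaryGroupOfForm (galAdicCompletionMap (L := L) (IsCMField.complexConj L) hw) (placeForm H' w.1))) : GL (Fin 3) (w.1.adicCompletion L)) : Matrix (Fin 3) (Fin 3) (w.1.adicCompletion L)) = M := (coe_localNonsplitEquiv_apply L H' v w hw k)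
  -- unitarity and integrality of `M`
  have hU : (M.map (galAdicCompletionMap (L := L) (IsCMField.complexConj L) hw))ᵀ * (placeForm H' w.1) * M = (placeForm H' w.1) := by
    have h := mem_unitaryGroupOfForm_iff.1 (localNonsplitEquiv (IsCMField.complexConj L) H' hc1 w hw k).2
    rwa [hMe] at h
  have hMint : ValBound 1 M := by
    rw [← hMe]
    exact valBound_one_of_mem_glInt ((mem_localIntegralLevel_iff_of_smul_eq (IsCMField.complexConj L) 3 H' hc1 w hw k).1 hk)
  have hJint : ValBound 1 (placeForm H' w.1) := fun i j => (Valuation.mem_integer_iff _ _).1 (((mem_glInt_iff _).1 hH'i).1 i j)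
  have hval1 : ∀ {x : (w.1.adicCompletion L)}, Valued.v x ≤ 1 → valuation (w.1.adicCompletion L) x ≤ 1 := fun {x} hx => by
    have h := (v_le_iff_valuation_le x 1).1 (by rwa [map_one]); rwa [map_one] at h
  have hXint : ValBound 1 (ϖ⁻¹ • (M - 1)) := fun a b => by
    rw [Matrix.smul_apply, smul_eq_mul, Matrix.sub_apply]; exact hval1 (hk1 a b)
  have hϖne : ϖ ≠ 0 := fun h0 => by rw [h0, map_zero] at hϖ; exact WithZero.coe_ne_zero hϖ.symm
  -- `σ_w` preserves integrality; the `σ`-image of `X`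
  have hσint : ∀ {Y : Matrix (Fin 3) (Fin 3) (w.1.adicCompletion L)}, ValBound 1 Y → ValBound 1 (Y.map (galAdicCompletionMap (L := L) (IsCMField.complexConj L) hw)) := fun {Y} hY a b => by
    rw [Matrix.map_apply]
    exact (Valuation.mem_integer_iff _ _).1 (red_galAdicCompletionMap_eq_of_ramified L v w hw he ((Valuation.mem_integer_iff _ _).2 (hY a b))).1
  -- (1) `H′ (M − 1) = −σ(M − 1)ᵀ H′ M` from unitarity
  have h1 : (placeForm H' w.1) * (M - 1) = -(((M - 1).map (galAdicCompletionMap (L := L) (IsCMField.complexConj L) hw))ᵀ * (placeForm H' w.1) * M) := by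
    have hmap : (M - 1).map (galAdicCompletionMap (L := L) (IsCMField.complexConj L) hw) = M.map (galAdicCompletionMap (L := L) (IsCMField.complexConj L) hw) - 1 := by
      rw [Matrix.map_sub _ (map_sub _), Matrix.map_one _ (map_zero _) (map_one _)]
    rw [hmap, Matrix.transpose_sub, Matrix.transpose_one, Matrix.sub_mul, Matrix.sub_mul, Matrix.one_mul, hU, Matrix.mul_sub, Matrix.mul_one, neg_sub]
  -- (2) `σ(M − 1) = −ϖ • σ(X)` and hence `H′ X = σ(X)ᵀ H′ M`
  have hD : M - 1 = ϖ • (ϖ⁻¹ • (M - 1)) := by rw [smul_smul, mul_inv_cancel₀ hϖne, one_smul]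
  have h2 : (placeForm H' w.1) * (ϖ⁻¹ • (M - 1)) = ((ϖ⁻¹ • (M - 1)).map (galAdicCompletionMap (L := L) (IsCMField.complexConj L) hw))ᵀ * (placeForm H' w.1) * M := by
    have hσD : (M - 1).map (galAdicCompletionMap (L := L) (IsCMField.complexConj L) hw) = -(ϖ • (ϖ⁻¹ • (M - 1)).map (galAdicCompletionMap (L := L) (IsCMField.complexConj L) hw)) := by
      conv_lhs => rw [hD]
      rw [map_smul_ringHom, hσϖ, neg_smul]
    have h := h1
    rw [hσD, Matrix.transpose_neg, Matrix.transpose_smul, Matrix.neg_mul, Matrix.neg_mul, neg_neg, Matrix.smul_mul, Matrix.smul_mul] at h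
    -- `h : H′ (M − 1) = ϖ • (σXᵀ H′ M)`; divide by `ϖ`
    have h' := congrArg (fun Y : Matrix (Fin 3) (Fin 3) (w.1.adicCompletion L) => ϖ⁻¹ • Y) h
    simp only [smul_smul, inv_mul_cancel₀ hϖne, one_smul] at h'
    rw [Matrix.mul_smul, h']
  -- (3) reduce: `J̄ X̄ = σ̄(X̄)ᵀ J̄ M̄ = X̄ᵀ J̄` (`M̄ = 1`, `σ̄ = id`)
  have hredM : redMat M = 1 := by
    have hsub : redMat (M - 1) = 0 := by
      refine (redMat_eq_zero_iff_forall_valuation_lt_one (hMint.sub (by intro a b; rw [Matrix.one_apply]; split_ifs <;> simp))).2 fun a b => ?_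
      have hab : valuation (w.1.adicCompletion L) (ϖ⁻¹ * (M a b - (1 : Matrix (Fin 3) (Fin 3) (w.1.adicCompletion L)) a b)) ≤ 1 := hval1 (hk1 a b)
      have hϖ1 : valuation (w.1.adicCompletion L) ϖ < 1 := (isUniformizingElement_of_v_eq hϖ).valuation_lt_one
      have hm : (M - 1) a b = ϖ * (ϖ⁻¹ * (M a b - (1 : Matrix (Fin 3) (Fin 3) (w.1.adicCompletion L)) a b)) := by
        rw [← mul_assoc, mul_inv_cancel₀ hϖne, one_mul, Matrix.sub_apply]
      rw [hm, map_mul]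
      exact lt_of_le_of_lt (mul_le_of_le_one_right' hab) hϖ1
    have h := redMat_sub hMint (show ValBound 1 (1 : Matrix (Fin 3) (Fin 3) (w.1.adicCompletion L)) from fun a b => by rw [Matrix.one_apply]; split_ifs <;> simp)
    rw [hsub, redMat_one] at h
    exact (sub_eq_zero.1 h.symm)
  have hred := congrArg redMat h2
  have hσX : ValBound 1 ((ϖ⁻¹ • (M - 1)).map (galAdicCompletionMap (L := L) (IsCMField.complexConj L) hw)) := hσint hXint
  have hσXT : ValBound 1 ((ϖ⁻¹ • (M - 1)).map (galAdicCompletionMap (L := L) (IsCMField.complexConj L) hw))ᵀ := IntegralReduction.ValBound.transpose' hσX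
  have hσXTJ : ValBound 1 (((ϖ⁻¹ • (M - 1)).map (galAdicCompletionMap (L := L) (IsCMField.complexConj L) hw))ᵀ * (placeForm H' w.1)) := by
    have h := hσXT.mul hJint; rwa [one_mul] at h
  rw [redMat_mul hJint hXint, redMat_mul hσXTJ hMint, redMat_mul hσXT hJint, hredM, Matrix.mul_one, redMat_transpose,
    redMat_map_galAdicCompletionMap_eq_of_ramified L v w hw he (fun i j => (Valuation.mem_integer_iff _ _).2 (hXint i j))] at hred
  exact hred

end SymmetricLayer

/-! ## §C The strata-value rows (R2)(R3)(R4)(R5) of the two-layer (U)-ram head -/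

section Rows

/-- `(a • z)ᵀ M (a • z) = a² · zᵀ M z`. [folklore] -/
private theorem smul_dotProduct_mulVec_smul {R : Type*} [CommRing R] (a : R) (M : Matrix (Fin 3) (Fin 3) R) (z : Fin 3 → R) :
    (a • z) ⬝ᵥ (M *ᵥ (a • z)) = a ^ 2 * (z ⬝ᵥ (M *ᵥ z)) := by
  rw [Matrix.mulVec_smul, dotProduct_smul, smul_dotProduct, smul_eq_mul, smul_eq_mul, pow_two, mul_assoc]

set_option maxHeartbeats 1600000 in
-- budget only: statement-heavy declaration (the CM-place tokens of the fold's socket :118, four conjuncts); no search tactic runs long here.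
/-- **«(U)-ram DEPTH 1 — STRATA VALUES»: rows (R2)(R3)(R4)(R5) of F0P2-p01 (g15)'s two-layer head `exists_twoLayerStrataValues_of_levelOne_ramified` (sf v2 42aa586084cc7c78, conjunction-hypothesis form), VERBATIM.**
For a `v`-LEVEL-1 `K`-class piece `g` (Ad `K`-invariant, left-invariant under `K(ϖ_v) = K_w(2)`, level token `(ι_w ϖ_v)^1`) at a tame-ramified `w` there are `c′ : ℕ → ℂ` and
`c₁ : 𝓀_w → ℂ` with: `g k = c′ 0` on `k ∈ K` of depth-1 rank `0` (R2), `g k = c′ 2` on depth-1 rank `2` (R3), `g k = c₁ (zᵀ(J̄N(k))z)` on depth-1 rank `1` for every `z` with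
`zᵀ(J̄N(k))z ≠ 0` (R4), and `c₁ (a²t) = c₁ t` for `a ≠ 0` (R5) — `N(k) = red(ϖ⁻¹(k_w − 1))`, `J̄ = red H′_w`.  Proof: `N(k) ∈ 𝔭(J̄)` (§B), `J̄ = c̄ • Āᵀ J₀ Ā`
(★ `exists_residueFrame_of_integralFrame`), `O(J̄)`-conjugacy from (rank, common value) ★ p846957 (F0P3-p03 (g14)), conjugacy ⇒ equal values ★ p846899; `c′, c₁` by choice.
[cite: Rogawski1990, §4.9 p. 54; §3.9 p. 32] [cite: BruhatTits1972, §10] [cite: CollingwoodMcGovern1993, §9.3] -/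
theorem exists_depthOneStrataValues_of_levelOne_ramified
    (L : Type) [Field L] [NumberField L] [IsCMField L] (H' : Matrix (Fin 3) (Fin 3) L)
    {v : HeightOneSpectrum (𝓞 ↥(maximalRealSubfield L))}
    (hH' : (H'.map (cmConjRingHom L)).transpose = H') (w : PlacesOver L v)
    (hw : IsCMField.complexConj L • w.1 = w.1) (he : v.asIdeal.ramificationIdx' w.1.asIdeal ≠ 1)
    (hH'w : IsUnit (placeForm H' w.1)) (hH'i : hH'w.unit ∈ glInt 3 (w.1.adicCompletion L))
    (h2 : IsUnit (2 : 𝒪[(w.1.adicCompletion L)]))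
    (ϖ : (w.1.adicCompletion L)) (hϖ : Valued.v ϖ = WithZero.exp (-1 : ℤ)) (hσϖ : galAdicCompletionMap (L := L) (IsCMField.complexConj L) hw ϖ = -ϖ)
    (A : GL (Fin 3) (w.1.adicCompletion L)) (hA : A ∈ glInt 3 (w.1.adicCompletion L))
    (hframe : placeForm H' w.1 = (-(placeForm H' w.1).det) • formCongr (galAdicCompletionMap (L := L) (IsCMField.complexConj L) hw) A ((StdForm.antidiagonal 3).over (w.1.adicCompletion L)))
    (g : ((cmDatum L 3 H').Local v) → ℂ)
    (hginv : ∀ u ∈ cmLocalIntegralLevel L 3 H' v, ∀ x, g (u * x * u⁻¹) = g x)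
    (hg1 : ∀ u : ((cmDatum L 3 H').Local v),
      (∀ a b, Valued.v (((toPlace v w (HeckeCharacter.uniformizer ↥(maximalRealSubfield L) v : v.adicCompletion ↥(maximalRealSubfield L))) ^ 1)⁻¹ *
        ((((localNonsplitEquiv (IsCMField.complexConj L) H' (IsCMField.complexConj_ne_one L) w hw u :
            ↥(unitaryGroupOfForm (galAdicCompletionMap (L := L) (IsCMField.complexConj L) hw) (placeForm H' w.1))) : GL (Fin 3) (w.1.adicCompletion L)) :
              Matrix (Fin 3) (Fin 3) (w.1.adicCompletion L)) a b - (1 : Matrix (Fin 3) (Fin 3) (w.1.adicCompletion L)) a b)) ≤ 1) →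
      ∀ x, g (u * x) = g x) :
    ∃ (c' : ℕ → ℂ) (c₁ : 𝓀[(w.1.adicCompletion L)] → ℂ),
      -- (R2) INTERIOR, depth-1 rank 0 (`x_w ≡ 1 (ϖ_w²)`)
      (∀ x : ((cmDatum L 3 H').Local v), (x ∈ cmLocalIntegralLevel L 3 H' v ∧
        (∀ a b, Valued.v (ϖ⁻¹ * ((((x).val : GL (Fin 3) (UnitaryGroup.LocalRing L v)).val.map (Pi.evalRingHom (fun w' : PlacesOver L v => w'.1.adicCompletion L) w)) a b - (1 : Matrix (Fin 3) (Fin 3) (w.1.adicCompletion L)) a b)) ≤ 1) ∧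
        (redMat (ϖ⁻¹ • ((((x).val : GL (Fin 3) (UnitaryGroup.LocalRing L v)).val.map (Pi.evalRingHom (fun w' : PlacesOver L v => w'.1.adicCompletion L) w)) - 1))) ^ 3 = 0 ∧ (redMat (ϖ⁻¹ • ((((x).val : GL (Fin 3) (UnitaryGroup.LocalRing L v)).val.map (Pi.evalRingHom (fun w' : PlacesOver L v => w'.1.adicCompletion L) w)) - 1))).rank = 0) →
        g x = c' 0) ∧
      -- (R3) INTERIOR, depth-1 rank 2 (regular nilpotent in `𝔭`)
      (∀ x : ((cmDatum L 3 H').Local v), (x ∈ cmLocalIntegralLevel L 3 H' v ∧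
        (∀ a b, Valued.v (ϖ⁻¹ * ((((x).val : GL (Fin 3) (UnitaryGroup.LocalRing L v)).val.map (Pi.evalRingHom (fun w' : PlacesOver L v => w'.1.adicCompletion L) w)) a b - (1 : Matrix (Fin 3) (Fin 3) (w.1.adicCompletion L)) a b)) ≤ 1) ∧
        (redMat (ϖ⁻¹ • ((((x).val : GL (Fin 3) (UnitaryGroup.LocalRing L v)).val.map (Pi.evalRingHom (fun w' : PlacesOver L v => w'.1.adicCompletion L) w)) - 1))) ^ 3 = 0 ∧ (redMat (ϖ⁻¹ • ((((x).val : GL (Fin 3) (UnitaryGroup.LocalRing L v)).val.map (Pi.evalRingHom (fun w' : PlacesOver L v => w'.1.adicCompletion L) w)) - 1))).rank = 2) →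
        g x = c' 2) ∧
      -- (R4) INTERIOR, depth-1 rank 1, indexed by the (non-zero) VALUE of the residual quadratic form `z ↦ z ⬝ᵥ (J̄ N) *ᵥ z`
      (∀ (x : ((cmDatum L 3 H').Local v)) (z : Fin 3 → 𝓀[(w.1.adicCompletion L)]), (x ∈ cmLocalIntegralLevel L 3 H' v ∧
        (∀ a b, Valued.v (ϖ⁻¹ * ((((x).val : GL (Fin 3) (UnitaryGroup.LocalRing L v)).val.map (Pi.evalRingHom (fun w' : PlacesOver L v => w'.1.adicCompletion L) w)) a b - (1 : Matrix (Fin 3) (Fin 3) (w.1.adicCompletion L)) a b)) ≤ 1) ∧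
        (redMat (ϖ⁻¹ • ((((x).val : GL (Fin 3) (UnitaryGroup.LocalRing L v)).val.map (Pi.evalRingHom (fun w' : PlacesOver L v => w'.1.adicCompletion L) w)) - 1))) ^ 3 = 0 ∧ (redMat (ϖ⁻¹ • ((((x).val : GL (Fin 3) (UnitaryGroup.LocalRing L v)).val.map (Pi.evalRingHom (fun w' : PlacesOver L v => w'.1.adicCompletion L) w)) - 1))).rank = 1 ∧
        z ⬝ᵥ ((redMat (placeForm H' w.1) * redMat (ϖ⁻¹ • ((((x).val : GL (Fin 3) (UnitaryGroup.LocalRing L v)).val.map (Pi.evalRingHom (fun w' : PlacesOver L v => w'.1.adicCompletion L) w)) - 1))) *ᵥ z) ≠ 0) →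
        g x = c₁ (z ⬝ᵥ ((redMat (placeForm H' w.1) * redMat (ϖ⁻¹ • ((((x).val : GL (Fin 3) (UnitaryGroup.LocalRing L v)).val.map (Pi.evalRingHom (fun w' : PlacesOver L v => w'.1.adicCompletion L) w)) - 1))) *ᵥ z))) ∧
      -- (R5) the rank-1 index is a residue SQUARE CLASS
      (∀ t a : 𝓀[(w.1.adicCompletion L)], a ≠ 0 → c₁ (a ^ 2 * t) = c₁ t) := by
  classical
  have hc1 : IsCMField.complexConj L ≠ 1 := IsCMField.complexConj_ne_one L
  -- §0 the place `w`: `σ_w` integral, its residue action is the identity (ramified), `char 𝓀_w ≠ 2`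
  have hσO : ∀ x : 𝒪[(w.1.adicCompletion L)], (galAdicCompletionMap (L := L) (IsCMField.complexConj L) hw) x ∈ 𝒪[(w.1.adicCompletion L)] := mem_integer_galAdicCompletionMap (IsCMField.complexConj L) v w hw
  obtain ⟨σk, hσk⟩ := exists_residueField_ringHom_galAdicCompletionMap (IsCMField.complexConj L) v w hw
  have hidx : ∀ y, σk y = y := residueHom_galAdicCompletionMap_eq_self_of_ramified (IsCMField.complexConj L) v hc1 w hw he σk hσO hσk
  have hid : σk = RingHom.id _ := RingHom.ext hidx
  subst hid
  have h2k : (2 : 𝓀[(w.1.adicCompletion L)]) ≠ 0 := by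
    have h := h2.map (IsLocalRing.residue 𝒪[(w.1.adicCompletion L)])
    rw [map_ofNat] at h
    exact h.ne_zero
  -- §1 the integral model `J_𝒪` of `J = H′_w` (unimodular)
  have hJint : ∀ i j, (placeForm H' w.1) i j ∈ 𝒪[(w.1.adicCompletion L)] := fun i j => ((mem_glInt_iff _).1 hH'i).1 i j
  have hJinv : ∀ i j, (((hH'w.unit⁻¹ : (Matrix (Fin 3) (Fin 3) (w.1.adicCompletion L))ˣ) : Matrix (Fin 3) (Fin 3) (w.1.adicCompletion L))) i j ∈ 𝒪[(w.1.adicCompletion L)] :=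
    fun i j => ((mem_glInt_iff _).1 hH'i).2 i j
  let JO : Matrix (Fin 3) (Fin 3) 𝒪[(w.1.adicCompletion L)] := Matrix.of fun i j => ⟨(placeForm H' w.1) i j, hJint i j⟩
  have hJ : (placeForm H' w.1) = JO.map ((↑) : 𝒪[(w.1.adicCompletion L)] → (w.1.adicCompletion L)) := by ext i j; rfl
  have hinjO : Function.Injective (fun M : Matrix (Fin 3) (Fin 3) 𝒪[(w.1.adicCompletion L)] => M.map ((↑) : 𝒪[(w.1.adicCompletion L)] → (w.1.adicCompletion L))) :=
    Matrix.map_injective Subtype.val_injective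
  have hJOdet : IsUnit JO.det := by
    let JI : Matrix (Fin 3) (Fin 3) 𝒪[(w.1.adicCompletion L)] :=
      Matrix.of fun i j => ⟨(((hH'w.unit⁻¹ : (Matrix (Fin 3) (Fin 3) (w.1.adicCompletion L))ˣ) : Matrix (Fin 3) (Fin 3) (w.1.adicCompletion L))) i j, hJinv i j⟩
    have hJI : (((hH'w.unit⁻¹ : (Matrix (Fin 3) (Fin 3) (w.1.adicCompletion L))ˣ) : Matrix (Fin 3) (Fin 3) (w.1.adicCompletion L))) = JI.map ((↑) : 𝒪[(w.1.adicCompletion L)] → (w.1.adicCompletion L)) := by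
      ext i j; rfl
    have hmul : JO * JI = 1 := by
      apply hinjO
      change (JO * JI).map ⇑(𝒪[(w.1.adicCompletion L)]).subtype = (1 : Matrix (Fin 3) (Fin 3) 𝒪[(w.1.adicCompletion L)]).map ⇑(𝒪[(w.1.adicCompletion L)]).subtype
      rw [Matrix.map_mul, Matrix.map_one (𝒪[(w.1.adicCompletion L)]).subtype (map_zero _) (map_one _)]
      change JO.map ((↑) : 𝒪[(w.1.adicCompletion L)] → (w.1.adicCompletion L)) * JI.map ((↑) : 𝒪[(w.1.adicCompletion L)] → (w.1.adicCompletion L)) = 1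
      rw [← hJ, ← hJI]
      have hmi := hH'w.unit.mul_inv
      rw [hH'w.unit_spec] at hmi
      exact hmi
    exact Matrix.isUnit_det_of_right_inverse hmul
  have hJred : redMat (placeForm H' w.1) = JO.map (IsLocalRing.residue 𝒪[(w.1.adicCompletion L)]) := by
    rw [hJ]; exact redMat_mapMatrix JO
  have hJbardet : IsUnit (redMat (placeForm H' w.1)).det := by
    rw [hJred, ← RingHom.mapMatrix_apply, ← RingHom.map_det]
    exact hJOdet.map _
  clear_value JO
  -- §2 the residual frame `J̄ = c̄ • ᵗ(Ā) J₀ Ā`, `c̄ = red(−det H′_w) ≠ 0` (★ p846857 §B on the fold's integral antidiagonal frame)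
  have hdetO : ((JO.det : 𝒪[(w.1.adicCompletion L)]) : (w.1.adicCompletion L)) = ((placeForm H' w.1)).det := by
    rw [hJ]
    exact (RingHom.map_det (𝒪[(w.1.adicCompletion L)]).subtype JO).symm
  have hcO : (((-JO.det : 𝒪[(w.1.adicCompletion L)])) : (w.1.adicCompletion L)) = -((placeForm H' w.1)).det := by rw [Subring.coe_neg, hdetO]
  obtain ⟨Ab, hAb⟩ := exists_residueFrame_of_integralFrame (galAdicCompletionMap (L := L) (IsCMField.complexConj L) hw) (RingHom.id 𝓀[(w.1.adicCompletion L)]) hσO hσk (placeForm H' w.1) JO hJ A hA (-JO.det) hcO hframe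
  have hcb : IsLocalRing.residue 𝒪[(w.1.adicCompletion L)] (-JO.det) ≠ 0 := by
    rw [map_neg, neg_ne_zero]
    exact (hJOdet.map _).ne_zero
  have hJb : redMat (placeForm H' w.1) = IsLocalRing.residue 𝒪[(w.1.adicCompletion L)] (-JO.det) • formCongr (RingHom.id 𝓀[(w.1.adicCompletion L)]) Ab ((StdForm.antidiagonal 3).over 𝓀[(w.1.adicCompletion L)]) := by
    rw [hJred]; exact hAb
  -- §3 the level token: `|ι_w ϖ_v|_w = exp(−2) = |ϖ²|_w`, so `hg1` is ★ p846899's `hg2w`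
  have hP := (valued_toPlace_uniformizer_of_ramified L (IsCMField.complexConj L) hc1 w hw he).1
  have hϖ2 : Valued.v (ϖ ^ 2) = WithZero.exp (-2 : ℤ) := by
    rw [map_pow, hϖ, ← WithZero.exp_nsmul]; norm_num
  have hg2w : ∀ u : ((cmDatum L 3 H').Local v), (∀ a b, Valued.v ((ϖ ^ 2)⁻¹ * (((((localNonsplitEquiv (IsCMField.complexConj L) H' (IsCMField.complexConj_ne_one L) w hw u) : ↥(unitaryGroupOfForm (galAdicCompletionMap (L := L) (IsCMField.complexConj L) hw) (placeForm H' w.1))) : GL (Fin 3) (w.1.adicCompletion L)) : Matrix (Fin 3) (Fin 3) (w.1.adicCompletion L)) a b - (1 : Matrix (Fin 3) (Fin 3) (w.1.adicCompletion L)) a b)) ≤ 1) → ∀ x, g (u * x) = g x := by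
    intro u hu
    refine hg1 u fun a b => ?_
    have h := hu a b
    rw [map_mul, map_inv₀, hϖ2] at h
    rw [map_mul, map_inv₀, pow_one, hP]
    exact h
  -- §4 symmetric layer in the consumer's token, and the core «conjugate residues ⇒ equal values» (★ p846899)
  have hsym : ∀ x : ((cmDatum L 3 H').Local v), x ∈ (cmLocalIntegralLevel L 3 H' v) → (∀ a b, Valued.v (ϖ⁻¹ * ((((x).val : GL (Fin 3) (UnitaryGroup.LocalRing L v)).val.map (Pi.evalRingHom (fun w' : PlacesOver L v => w'.1.adicCompletion L) w)) a b - (1 : Matrix (Fin 3) (Fin 3) (w.1.adicCompletion L)) a b)) ≤ 1) →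
      (redMat (placeForm H' w.1))⁻¹ * ((redMat (ϖ⁻¹ • ((((x).val : GL (Fin 3) (UnitaryGroup.LocalRing L v)).val.map (Pi.evalRingHom (fun w' : PlacesOver L v => w'.1.adicCompletion L) w)) - 1))).map (RingHom.id 𝓀[(w.1.adicCompletion L)]))ᵀ * redMat (placeForm H' w.1) = redMat (ϖ⁻¹ • ((((x).val : GL (Fin 3) (UnitaryGroup.LocalRing L v)).val.map (Pi.evalRingHom (fun w' : PlacesOver L v => w'.1.adicCompletion L) w)) - 1)) := by
    intro x hx hx1
    have h := redMat_placeForm_mul_depthOne_eq_transpose_mul_of_ramified L H' w hw he hH'w hH'i ϖ hϖ hσϖ hx hx1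
    exact (formAdjoint_id_eq_self_iff_transpose_mul hJbardet).2 h.symm
  have hcore : ∀ x x' : ((cmDatum L 3 H').Local v), x ∈ (cmLocalIntegralLevel L 3 H' v) → x' ∈ (cmLocalIntegralLevel L 3 H' v) → (∀ a b, Valued.v (ϖ⁻¹ * ((((x).val : GL (Fin 3) (UnitaryGroup.LocalRing L v)).val.map (Pi.evalRingHom (fun w' : PlacesOver L v => w'.1.adicCompletion L) w)) a b - (1 : Matrix (Fin 3) (Fin 3) (w.1.adicCompletion L)) a b)) ≤ 1) → (∀ a b, Valued.v (ϖ⁻¹ * ((((x').val : GL (Fin 3) (UnitaryGroup.LocalRing L v)).val.map (Pi.evalRingHom (fun w' : PlacesOver L v => w'.1.adicCompletion L) w)) a b - (1 : Matrix (Fin 3) (Fin 3) (w.1.adicCompletion L)) a b)) ≤ 1) →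
      (∃ y : GL (Fin 3) 𝓀[(w.1.adicCompletion L)], y ∈ unitaryGroupOfForm (RingHom.id 𝓀[(w.1.adicCompletion L)]) (redMat (placeForm H' w.1)) ∧
        (y : Matrix (Fin 3) (Fin 3) 𝓀[(w.1.adicCompletion L)]) * redMat (ϖ⁻¹ • ((((x).val : GL (Fin 3) (UnitaryGroup.LocalRing L v)).val.map (Pi.evalRingHom (fun w' : PlacesOver L v => w'.1.adicCompletion L) w)) - 1)) * ((y⁻¹ : GL (Fin 3) 𝓀[(w.1.adicCompletion L)]) : Matrix (Fin 3) (Fin 3) 𝓀[(w.1.adicCompletion L)]) = redMat (ϖ⁻¹ • ((((x').val : GL (Fin 3) (UnitaryGroup.LocalRing L v)).val.map (Pi.evalRingHom (fun w' : PlacesOver L v => w'.1.adicCompletion L) w)) - 1))) → g x = g x' :=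
    fun x x' hx hx' hx1 hx1' hconj =>
      apply_eq_apply_of_depthOne_conj_ramified L H' hH' w hw he hH'w hH'i h2 ϖ hϖ g hginv hg2w hx hx' hx1 hx1' hconj
  have hnil : ∀ x : ((cmDatum L 3 H').Local v), (redMat (ϖ⁻¹ • ((((x).val : GL (Fin 3) (UnitaryGroup.LocalRing L v)).val.map (Pi.evalRingHom (fun w' : PlacesOver L v => w'.1.adicCompletion L) w)) - 1))) ^ 3 = 0 → IsNilpotent (redMat (ϖ⁻¹ • ((((x).val : GL (Fin 3) (UnitaryGroup.LocalRing L v)).val.map (Pi.evalRingHom (fun w' : PlacesOver L v => w'.1.adicCompletion L) w)) - 1))) := fun x h => ⟨3, h⟩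
  -- §5 the choice functions
  let P2 : ℕ → Prop := fun r => ∃ x : ((cmDatum L 3 H').Local v), x ∈ (cmLocalIntegralLevel L 3 H' v) ∧ (∀ a b, Valued.v (ϖ⁻¹ * ((((x).val : GL (Fin 3) (UnitaryGroup.LocalRing L v)).val.map (Pi.evalRingHom (fun w' : PlacesOver L v => w'.1.adicCompletion L) w)) a b - (1 : Matrix (Fin 3) (Fin 3) (w.1.adicCompletion L)) a b)) ≤ 1) ∧ (redMat (ϖ⁻¹ • ((((x).val : GL (Fin 3) (UnitaryGroup.LocalRing L v)).val.map (Pi.evalRingHom (fun w' : PlacesOver L v => w'.1.adicCompletion L) w)) - 1))) ^ 3 = 0 ∧ (redMat (ϖ⁻¹ • ((((x).val : GL (Fin 3) (UnitaryGroup.LocalRing L v)).val.map (Pi.evalRingHom (fun w' : PlacesOver L v => w'.1.adicCompletion L) w)) - 1))).rank = r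
  let P1 : 𝓀[(w.1.adicCompletion L)] → Prop := fun t => ∃ x : ((cmDatum L 3 H').Local v), ∃ z : Fin 3 → 𝓀[(w.1.adicCompletion L)], x ∈ (cmLocalIntegralLevel L 3 H' v) ∧ (∀ a b, Valued.v (ϖ⁻¹ * ((((x).val : GL (Fin 3) (UnitaryGroup.LocalRing L v)).val.map (Pi.evalRingHom (fun w' : PlacesOver L v => w'.1.adicCompletion L) w)) a b - (1 : Matrix (Fin 3) (Fin 3) (w.1.adicCompletion L)) a b)) ≤ 1) ∧ (redMat (ϖ⁻¹ • ((((x).val : GL (Fin 3) (UnitaryGroup.LocalRing L v)).val.map (Pi.evalRingHom (fun w' : PlacesOver L v => w'.1.adicCompletion L) w)) - 1))) ^ 3 = 0 ∧ (redMat (ϖ⁻¹ • ((((x).val : GL (Fin 3) (UnitaryGroup.LocalRing L v)).val.map (Pi.evalRingHom (fun w' : PlacesOver L v => w'.1.adicCompletion L) w)) - 1))).rank = 1 ∧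
    z ⬝ᵥ ((redMat (placeForm H' w.1) * redMat (ϖ⁻¹ • ((((x).val : GL (Fin 3) (UnitaryGroup.LocalRing L v)).val.map (Pi.evalRingHom (fun w' : PlacesOver L v => w'.1.adicCompletion L) w)) - 1))) *ᵥ z) = t ∧ t ≠ 0
  refine ⟨fun r => if h : P2 r then g h.choose else 0, fun t => if h : P1 t then g h.choose else 0, ?_, ?_, ?_, ?_⟩
  · -- (R2) rank 0: `N(x) = 0 = N(x₀)`, conjugate by `1`
    rintro x ⟨hx, hx1, hn, hr⟩
    have hPx : P2 0 := ⟨x, hx, hx1, hn, hr⟩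
    simp only [dif_pos hPx]
    obtain ⟨hx₀, hx₀1, hn₀, hr₀⟩ := hPx.choose_spec
    refine hcore x _ hx hx₀ hx1 hx₀1 ⟨1, one_mem _, ?_⟩
    rw [(Literature.NumberTheory.Automorphic.rank_eq_zero_iff_eq_zero _).1 hr, (Literature.NumberTheory.Automorphic.rank_eq_zero_iff_eq_zero _).1 hr₀,
      Matrix.mul_zero, Matrix.zero_mul]
  · -- (R3) rank 2: (1 : Matrix (Fin 3) (Fin 3) (w.1.adicCompletion L)) orbit ★ (F2)
    rintro x ⟨hx, hx1, hn, hr⟩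
    have hPx : P2 2 := ⟨x, hx, hx1, hn, hr⟩
    simp only [dif_pos hPx]
    obtain ⟨hx₀, hx₀1, hn₀, hr₀⟩ := hPx.choose_spec
    exact hcore x _ hx hx₀ hx1 hx₀1
      (exists_conj_eq_of_isNilpotent_of_rank_eq_two_of_residueFrame h2k (fun _ => rfl) Ab hcb hJb (hsym x hx hx1) (hsym _ hx₀ hx₀1)
        (hnil x hn) (hnil _ hn₀) hr hr₀)
  · -- (R4) rank 1: orbits by the common non-zero value ★ (F3)
    rintro x z ⟨hx, hx1, hn, hr, hz⟩
    have hPx : P1 (z ⬝ᵥ ((redMat (placeForm H' w.1) * redMat (ϖ⁻¹ • ((((x).val : GL (Fin 3) (UnitaryGroup.LocalRing L v)).val.map (Pi.evalRingHom (fun w' : PlacesOver L v => w'.1.adicCompletion L) w)) - 1))) *ᵥ z)) := ⟨x, z, hx, hx1, hn, hr, rfl, hz⟩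
    simp only [dif_pos hPx]
    obtain ⟨z₀, hx₀, hx₀1, hn₀, hr₀, hz₀, -⟩ := hPx.choose_spec
    exact hcore x _ hx hx₀ hx1 hx₀1
      (exists_conj_eq_of_isNilpotent_of_rank_le_one_of_common_value_of_residueFrame (fun _ => rfl) Ab hcb hJb (hsym x hx hx1) (hsym _ hx₀ hx₀1)
        (hnil x hn) (hnil _ hn₀) hr.le hr₀.le hz rfl hz₀)
  · -- (R5) the value only matters modulo squares: rescale `z`
    intro t a ha
    have hscale : ∀ {x : ((cmDatum L 3 H').Local v)} {z : Fin 3 → 𝓀[(w.1.adicCompletion L)]} {s : 𝓀[(w.1.adicCompletion L)]}, z ⬝ᵥ ((redMat (placeForm H' w.1) * redMat (ϖ⁻¹ • ((((x).val : GL (Fin 3) (UnitaryGroup.LocalRing L v)).val.map (Pi.evalRingHom (fun w' : PlacesOver L v => w'.1.adicCompletion L) w)) - 1))) *ᵥ z) = s →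
        (a • z) ⬝ᵥ ((redMat (placeForm H' w.1) * redMat (ϖ⁻¹ • ((((x).val : GL (Fin 3) (UnitaryGroup.LocalRing L v)).val.map (Pi.evalRingHom (fun w' : PlacesOver L v => w'.1.adicCompletion L) w)) - 1))) *ᵥ (a • z)) = a ^ 2 * s := fun {x} {z} {s} h => by
      rw [smul_dotProduct_mulVec_smul, h]
    have hscale' : ∀ {x : ((cmDatum L 3 H').Local v)} {z : Fin 3 → 𝓀[(w.1.adicCompletion L)]} {s : 𝓀[(w.1.adicCompletion L)]}, z ⬝ᵥ ((redMat (placeForm H' w.1) * redMat (ϖ⁻¹ • ((((x).val : GL (Fin 3) (UnitaryGroup.LocalRing L v)).val.map (Pi.evalRingHom (fun w' : PlacesOver L v => w'.1.adicCompletion L) w)) - 1))) *ᵥ z) = a ^ 2 * s →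
        (a⁻¹ • z) ⬝ᵥ ((redMat (placeForm H' w.1) * redMat (ϖ⁻¹ • ((((x).val : GL (Fin 3) (UnitaryGroup.LocalRing L v)).val.map (Pi.evalRingHom (fun w' : PlacesOver L v => w'.1.adicCompletion L) w)) - 1))) *ᵥ (a⁻¹ • z)) = s := fun {x} {z} {s} h => by
      rw [smul_dotProduct_mulVec_smul, h, ← mul_assoc, ← mul_pow, inv_mul_cancel₀ ha, one_pow, one_mul]
    have ha2 : a ^ 2 ≠ 0 := pow_ne_zero 2 ha
    by_cases hPt : P1 t
    · obtain ⟨z₀, hx₀, hx₀1, hn₀, hr₀, hz₀, ht⟩ := hPt.choose_spec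
      have hPt' : P1 (a ^ 2 * t) := ⟨hPt.choose, a • z₀, hx₀, hx₀1, hn₀, hr₀, hscale hz₀, mul_ne_zero ha2 ht⟩
      simp only [dif_pos hPt', dif_pos hPt]
      obtain ⟨z₁, hx₁, hx₁1, hn₁, hr₁, hz₁, -⟩ := hPt'.choose_spec
      exact hcore _ _ hx₁ hx₀ hx₁1 hx₀1
        (exists_conj_eq_of_isNilpotent_of_rank_le_one_of_common_value_of_residueFrame (fun _ => rfl) Ab hcb hJb (hsym _ hx₁ hx₁1) (hsym _ hx₀ hx₀1)
          (hnil _ hn₁) (hnil _ hn₀) hr₁.le hr₀.le ht (hscale' hz₁) hz₀)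
    · have hPt' : ¬ P1 (a ^ 2 * t) := fun ⟨x, z, hx, hx1, hn, hr, hz, hne⟩ =>
        hPt ⟨x, a⁻¹ • z, hx, hx1, hn, hr, hscale' hz, fun ht0 => hne (by rw [ht0, mul_zero])⟩
      simp only [dif_neg hPt', dif_neg hPt]

end Rows

end Literature.NumberTheory.Rogawski1990

end
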